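import Mathlib.MeasureTheory.Integral.IntervalIntegral.Periodic
import Mathlib.MeasureTheory.Constructions.Pi
import Mathlib.MeasureTheory.Group.Integral
import Mathlib.MeasureTheory.Function.LocallyIntegrable
import Mathlib.Analysis.Calculus.ParametricIntegral
import Literature.Geometry.Kaehler.ComplexTorusCover
import HarnessLib

/-!
# Averaging forms over a complex torus; invariant forms are not exact

Companion of `Literature/Geometry/Kaehler/ComplexTorusCover.lean`. On the complex torus
`X = E/Φ(ℤ^ι)` (`ComplexTorus Φ`, a compact abelian Lie group with its normalised Haar measure,
here `volume` = the product of the Haar probability measures of the circles `ℝ/ℤ`):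

* `ComplexTorus.avg Φ β = ∫ₓ β(x) dx ∈ E [⋀^Fin k]→L[ℝ] F`, the **average** of a form (its
  values read in the canonical trivialisation `T_x X = E`); `avg (constForm c) = c`;
* `ComplexTorus.avg_mextDeriv`: **the average of an exact form vanishes**, `avg (dβ) = 0` for
  every form `β` with `C¹` lift — the integral `∫ₓ β(x + π v) dx` does not depend on `v ∈ E`
  (invariance of Haar measure), and its derivative in `v` at `0`, computed under the integral
  sign, is `∫ₓ Dβ̃`, whose alternatisation is `∫ₓ dβ` (`liftForm_mextDeriv`);
* hence `ComplexTorus.avgClass : H^k_dR(X; F) →ₗ Alt^k(E; F)` with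
  `avgClass ∘ constClass = id` (`avgClass_constClass`): **the classes of the invariant forms are
  linearly independent in de Rham cohomology** (`constClass_injective`; a non-zero invariant
  form is never exact, `constForm_mem_exactSmoothForms_iff`). This is the injectivity half of
  Lange–Birkenhake (1992), Prop. 1.1.20 (`IF^n(X) ≅ H^n_dR(X)`), proved there by duality with
  the homology basis; the averaging argument is that of Griffiths–Harris (1978), pp. 301–302 /
  Birkenhake–Lange, proof of Lemma 1.1.17 via invariant representatives.

## Not here

The surjectivity half of Prop. 1.1.20 (every closed form is cohomologous to its average), which
needs a homotopy operator for the translations.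

## References

* H. Lange, Ch. Birkenhake, *Complex Abelian Varieties*, Grundlehren 302 (1992), §1.1.4,
  Prop. 1.1.20. [LangeBirkenhake1992]
-/

noncomputable section

open scoped Manifold ContDiff Topology
open Bundle Set Filter MeasureTheory MeasureTheory.Measure

namespace Literature.Geometry.Kaehler

namespace ComplexTorus

variable {ι : Type*} {E : Type*} [NormedAddCommGroup E] [NormedSpace ℂ E] (Φ : (ι → ℝ) ≃L[ℝ] E)

/-! ### The torus as a measured group -/

/-- The covering map is additive. [folklore] -/
theorem cover_add (z w : E) : cover Φ (z + w) = cover Φ z + cover Φ w := by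
  rw [cover_apply, cover_apply, cover_apply, map_add, proj_add]

/-- `proj 0 = 0`. [folklore] -/
@[simp] theorem proj_zero : proj Φ 0 = 0 :=
  funext fun _ ↦ rfl

/-- `π 0 = 0`. [folklore] -/
@[simp] theorem cover_zero : cover Φ 0 = 0 := by
  rw [cover_apply, map_zero, proj_zero]

variable [Fintype ι]

/-- The Borel σ-algebra of the real torus. [folklore] -/
instance instMeasurableSpace : MeasurableSpace (ComplexTorus Φ) :=
  inferInstanceAs (MeasurableSpace (ι → AddCircle (1 : ℝ)))

/-- The σ-algebra is Borel. [folklore] -/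
instance instBorelSpace : BorelSpace (ComplexTorus Φ) :=
  inferInstanceAs (BorelSpace (ι → AddCircle (1 : ℝ)))

/-- The torus is second countable. [folklore] -/
instance instSecondCountableTopology : SecondCountableTopology (ComplexTorus Φ) :=
  inferInstanceAs (SecondCountableTopology (ι → AddCircle (1 : ℝ)))

/-- **Haar measure** on the torus: the product of the Haar probability measures of the circles
`ℝ/ℤ` (Mathlib's `volume` on `AddCircle 1`). [folklore] -/
instance instMeasureSpace : MeasureSpace (ComplexTorus Φ) :=
  inferInstanceAs (MeasureSpace (ι → AddCircle (1 : ℝ)))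

/-- The measure is a Haar measure (in particular translation invariant and finite on compacts).
[folklore] -/
instance instIsAddHaarMeasure : (volume : Measure (ComplexTorus Φ)).IsAddHaarMeasure :=
  inferInstanceAs ((volume : Measure (ι → AddCircle (1 : ℝ))).IsAddHaarMeasure)

/-- The measure is normalised: total mass `1`. [folklore] -/
instance instIsProbabilityMeasure : IsProbabilityMeasure (volume : Measure (ComplexTorus Φ)) := by
  constructor
  change Measure.pi (fun _ : ι ↦ (volume : Measure (AddCircle (1 : ℝ)))) univ = 1
  rw [Measure.pi_univ]
  simp [AddCircle.measure_univ]

/-! ### Continuous lattice-periodic functions descend to continuous functions -/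

section Descend

variable {Y : Type*}

/-- A function on `E` read at the canonical lift of a point of the torus (the centre of its
preferred chart). [folklore] -/
def descendFun (g : E → Y) : ComplexTorus Φ → Y := fun x ↦ g (extChartAt 𝓘(ℝ, E) x x)

/-- Unfolding of `descendFun`. [folklore] -/
theorem descendFun_apply (g : E → Y) (x : ComplexTorus Φ) :
    descendFun Φ g x = g (extChartAt 𝓘(ℝ, E) x x) :=
  rfl

/-- A lattice-periodic function is recovered from its descent: `g z = (descend g) (π z)`.
[folklore] -/
theorem descendFun_cover {g : E → Y} (hg : ∀ (z : E) (n : ι → ℤ), g (z + latticeVec Φ n) = g z)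
    (z : E) : descendFun Φ g (cover Φ z) = g z := by
  rw [descendFun_apply, extChartAt_cover_self]
  have h := hg (z - latticeVec Φ (boxIndex Φ (corner Φ (cover Φ z)) z))
    (boxIndex Φ (corner Φ (cover Φ z)) z)
  rw [sub_add_cancel] at h
  exact h.symm

/-- On the domain of the chart `chart Φ a`, the descent of a lattice-periodic `g` is `g ∘ chart Φ a`
(two lifts of the same point differ by a lattice vector). [folklore] -/
theorem descendFun_eq_comp_chart {g : E → Y} (hg : ∀ (z : E) (n : ι → ℤ), g (z + latticeVec Φ n) = g z)
    (a : ι → ℝ) {x : ComplexTorus Φ} (hx : x ∈ (chart Φ a).source) :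
    descendFun Φ g x = g (chart Φ a x) := by
  conv_lhs => rw [← proj_symm_chart Φ hx, ← cover_apply]
  exact descendFun_cover Φ hg _

variable [TopologicalSpace Y]

/-- **A continuous lattice-periodic function descends to a continuous function on the torus.**
[folklore] -/
theorem continuous_descendFun {g : E → Y} (hgc : Continuous g)
    (hg : ∀ (z : E) (n : ι → ℤ), g (z + latticeVec Φ n) = g z) : Continuous (descendFun Φ g) := by
  refine continuous_iff_continuousAt.2 fun x ↦ ?_
  have heq : (fun y ↦ g (chartAt E x y)) =ᶠ[𝓝 x] descendFun Φ g := by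
    filter_upwards [(chartAt E x).open_source.mem_nhds (mem_chart_source E x)] with y hy
    rw [chartAt_eq] at hy ⊢
    exact (descendFun_eq_comp_chart Φ hg _ hy).symm
  exact (hgc.continuousAt.comp ((chartAt E x).continuousAt (mem_chart_source E x))).congr heq

/-- A continuous lattice-periodic function with values in a normed group is bounded. [folklore] -/
theorem exists_bound_of_periodic {Y : Type*} [NormedAddCommGroup Y] {g : E → Y} (hgc : Continuous g)
    (hg : ∀ (z : E) (n : ι → ℤ), g (z + latticeVec Φ n) = g z) : ∃ C, ∀ z, ‖g z‖ ≤ C := by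
  obtain ⟨C, hC⟩ := isCompact_univ.exists_bound_of_continuousOn
    (continuous_descendFun Φ hgc hg).continuousOn
  exact ⟨C, fun z ↦ by simpa [descendFun_cover Φ hg z] using hC (cover Φ z) (mem_univ _)⟩

end Descend

/-! ### Values and averages of forms -/

section Forms

variable {F : Type*} [NormedAddCommGroup F] [NormedSpace ℝ F] {k : ℕ}

/-- The values of a form on the torus, read in the canonical trivialisation `T_x X = E`
(a non-dependent function `X → E [⋀^Fin k]→L[ℝ] F`). [folklore] -/
def val (β : MForm 𝓘(ℝ, E) (ComplexTorus Φ) F k) : ComplexTorus Φ → E [⋀^Fin k]→L[ℝ] F :=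
  fun x ↦ β x

/-- Unfolding of `val`. [folklore] -/
theorem val_apply (β : MForm 𝓘(ℝ, E) (ComplexTorus Φ) F k) (x : ComplexTorus Φ) :
    val Φ β x = β x :=
  rfl

/-- The values of the zero form. [folklore] -/
@[simp] theorem val_zero : val Φ (0 : MForm 𝓘(ℝ, E) (ComplexTorus Φ) F k) = 0 :=
  rfl

/-- The values of a form are the descent of its (periodic) lift. [folklore] -/
theorem val_eq_descendFun_liftForm (β : MForm 𝓘(ℝ, E) (ComplexTorus Φ) F k) :
    val Φ β = descendFun Φ (liftForm Φ β) := by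
  funext x
  rw [descendFun_apply, liftForm_apply]
  exact apply_congr Φ β (cover_extChartAt_self Φ x).symm

/-- `val β (π z) = liftForm β z`. [folklore] -/
theorem val_cover (β : MForm 𝓘(ℝ, E) (ComplexTorus Φ) F k) (z : E) :
    val Φ β (cover Φ z) = liftForm Φ β z :=
  rfl

/-- A form with continuous lift has continuous values. [folklore] -/
theorem continuous_val {β : MForm 𝓘(ℝ, E) (ComplexTorus Φ) F k} (hβ : Continuous (liftForm Φ β)) :
    Continuous (val Φ β) := by
  rw [val_eq_descendFun_liftForm]
  exact continuous_descendFun Φ hβ (liftForm_add_latticeVec Φ β)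

/-- A form with continuous lift has integrable values (the torus is compact). [folklore] -/
theorem integrable_val {β : MForm 𝓘(ℝ, E) (ComplexTorus Φ) F k} (hβ : Continuous (liftForm Φ β)) :
    Integrable (val Φ β) := by
  exact (continuous_val Φ hβ).integrable_of_hasCompactSupport (HasCompactSupport.of_compactSpace _)

/-- **The average of a form over the torus**, `∫ₓ β(x) dx ∈ Alt^k(E; F)` (normalised Haar
measure). Lange–Birkenhake (1992), §1.1.4 (invariant representatives). [cite: LangeBirkenhake1992, §1.1.4] -/
def avg (β : MForm 𝓘(ℝ, E) (ComplexTorus Φ) F k) : E [⋀^Fin k]→L[ℝ] F := ∫ x, val Φ β x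

/-- Unfolding of `avg`. [folklore] -/
theorem avg_def (β : MForm 𝓘(ℝ, E) (ComplexTorus Φ) F k) : avg Φ β = ∫ x, val Φ β x := rfl

/-- The average of the zero form. [folklore] -/
@[simp] theorem avg_zero : avg Φ (0 : MForm 𝓘(ℝ, E) (ComplexTorus Φ) F k) = 0 := by
  rw [avg_def, val_zero]
  exact integral_zero _ _

/-- **Translation invariance of the average**: `∫ₓ β(x + π v) dx = avg β` for every `v ∈ E`
(invariance of Haar measure). [folklore] -/
theorem integral_val_add_cover (β : MForm 𝓘(ℝ, E) (ComplexTorus Φ) F k) (v : E) :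
    ∫ x, val Φ β (x + cover Φ v) = avg Φ β :=
  integral_add_right_eq_self (μ := volume) (val Φ β) (cover Φ v)

/-- The average is additive on forms with continuous lifts. [folklore] -/
theorem avg_add {α β : MForm 𝓘(ℝ, E) (ComplexTorus Φ) F k} (hα : Continuous (liftForm Φ α))
    (hβ : Continuous (liftForm Φ β)) : avg Φ (α + β) = avg Φ α + avg Φ β := by
  rw [avg_def, avg_def, avg_def, ← integral_add (integrable_val Φ hα) (integrable_val Φ hβ)]
  rfl

/-- The average is homogeneous. [folklore] -/
theorem avg_smul (r : ℝ) (β : MForm 𝓘(ℝ, E) (ComplexTorus Φ) F k) : avg Φ (r • β) = r • avg Φ β := by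
  rw [avg_def, avg_def, ← integral_smul]
  rfl

variable [CompleteSpace F]

/-- **The average of an invariant form is its value**: `avg (constForm c) = c`.
[cite: LangeBirkenhake1992, §1.1.4] -/
@[simp] theorem avg_constForm (c : E [⋀^Fin k]→L[ℝ] F) : avg Φ (constForm Φ c) = c := by
  rw [avg_def]
  change ∫ _ : ComplexTorus Φ, c = c
  rw [integral_const]
  simp

set_option synthInstance.maxHeartbeats 200000 in
-- operator-norm instances on the iterated spaces `E →L[ℝ] E [⋀^Fin k]→L[ℝ] F` are slow to find
/-- **The average of an exact form is zero**: `avg (dβ) = 0` for every form `β` on the torus whose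
lift `β̃ = liftForm β` is `C¹`. The function `v ↦ ∫ₓ β(x + π v) dx = ∫ₓ β̃(x̃ + v) dx` is constant
(Haar invariance); differentiating under the integral sign at `v = 0` gives `∫ₓ Dβ̃(x̃) = 0`,
and `∫ₓ dβ = ∫ₓ Alt (Dβ̃)(x̃) = Alt (∫ₓ Dβ̃(x̃)) = 0` (`liftForm_mextDeriv`). This is the
computation behind "exact invariant forms vanish" in Lange–Birkenhake (1992), §1.1.4 /
Prop. 1.1.20. [cite: LangeBirkenhake1992, §1.1.4] -/
theorem avg_mextDeriv {β : MForm 𝓘(ℝ, E) (ComplexTorus Φ) F k} (hβ : ContDiff ℝ 1 (liftForm Φ β)) :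
    avg Φ (mextDeriv β) = 0 := by
  -- the operator-norm instances on `E →L[ℝ] E [⋀^Fin k]→L[ℝ] F`, found once
  letI iN : NormedAddCommGroup (E →L[ℝ] E [⋀^Fin k]→L[ℝ] F) := inferInstance
  letI iS : NormedSpace ℝ (E →L[ℝ] E [⋀^Fin k]→L[ℝ] F) := inferInstance
  set θ := liftForm Φ β with hθ
  have hθc : Continuous θ := hβ.continuous
  have hθd : Differentiable ℝ θ := hβ.differentiable one_ne_zero
  have hDc : Continuous (fderiv ℝ θ) := hβ.continuous_fderiv one_ne_zero
  have hDper : ∀ (z : E) (n : ι → ℤ), fderiv ℝ θ (z + latticeVec Φ n) = fderiv ℝ θ z := by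
    intro z n
    have h : θ = fun w ↦ θ (w + latticeVec Φ n) := by
      funext w; exact (liftForm_add_latticeVec Φ β w n).symm
    conv_rhs => rw [h, fderiv_comp_add_right]
  -- the lift of a point of the torus
  set s : ComplexTorus Φ → E := fun x ↦ extChartAt 𝓘(ℝ, E) x x with hs
  have hcs : ∀ x, cover Φ (s x) = x := fun x ↦ cover_extChartAt_self Φ x
  -- the parametrised integrand and its derivative
  set G : E → ComplexTorus Φ → E [⋀^Fin k]→L[ℝ] F := fun v x ↦ val Φ β (x + cover Φ v) with hG
  set G' : E → ComplexTorus Φ → E →L[ℝ] E [⋀^Fin k]→L[ℝ] F := fun v x ↦ fderiv ℝ θ (s x + v)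
    with hG'
  have hGθ : ∀ v x, G v x = θ (s x + v) := by
    intro v x
    simp only [hG, val_apply, hθ, liftForm_apply]
    exact apply_congr Φ β (by rw [cover_add, hcs])
  -- hypotheses of differentiation under the integral sign
  have hG_meas : ∀ᶠ v in 𝓝 (0 : E), AEStronglyMeasurable (G v) volume :=
    Eventually.of_forall fun v ↦ ((continuous_val Φ hθc).comp
      (continuous_id.add continuous_const)).aestronglyMeasurable
  have hG_int : Integrable (G 0) volume := by
    have : G 0 = val Φ β := by funext x; simp [hG]
    rw [this]
    exact integrable_val Φ hθc
  have hG'c : Continuous (G' 0) := by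
    have : G' 0 = descendFun Φ (fderiv ℝ θ) := by funext x; simp [hG', descendFun_apply, hs]
    rw [this]
    exact continuous_descendFun Φ hDc hDper
  have hG'_meas : AEStronglyMeasurable (G' 0) volume := hG'c.aestronglyMeasurable
  obtain ⟨C, hC⟩ := exists_bound_of_periodic Φ hDc hDper
  have h_bound : ∀ᵐ x ∂(volume : Measure (ComplexTorus Φ)), ∀ v ∈ (univ : Set E), ‖G' v x‖ ≤ C :=
    Eventually.of_forall fun x v _ ↦ hC _
  have h_diff : ∀ᵐ x ∂(volume : Measure (ComplexTorus Φ)), ∀ v ∈ (univ : Set E),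
      HasFDerivAt (G · x) (G' v x) v := by
    refine Eventually.of_forall fun x v _ ↦ ?_
    have hfun : (G · x) = fun w ↦ θ (s x + w) := funext fun w ↦ hGθ w x
    rw [hfun]
    have h := (hθd (s x + v)).hasFDerivAt.comp v ((hasFDerivAt_id v).const_add (s x))
    simpa [hG', Function.comp_def] using h
  have hD := hasFDerivAt_integral_of_dominated_of_fderiv_le (bound := fun _ ↦ C)
    (univ_mem : (univ : Set E) ∈ 𝓝 (0 : E)) hG_meas hG_int hG'_meas h_bound (integrable_const C) h_diff
  -- the parametrised integral is constant (Haar invariance), so its derivative vanishes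
  have hconst : (fun v ↦ ∫ x, G v x) = fun _ ↦ avg Φ β :=
    funext fun v ↦ integral_val_add_cover Φ β v
  rw [hconst] at hD
  have hzero : ∫ x, G' 0 x = 0 := hD.unique (hasFDerivAt_const (avg Φ β) 0)
  -- assemble: `avg (dβ) = Alt (∫ Dθ ∘ s) = Alt 0 = 0`
  have hval : ∀ x, val Φ (mextDeriv β) x =
      ContinuousAlternatingMap.alternatizeUncurryFinCLM ℝ E F (G' 0 x) := by
    intro x
    rw [val_eq_descendFun_liftForm, descendFun_apply, liftForm_mextDeriv]
    simp only [hG', add_zero, extDeriv, ContinuousAlternatingMap.alternatizeUncurryFinCLM_apply, hs, hθ]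
  rw [avg_def]
  simp only [hval]
  rw [ContinuousLinearMap.integral_comp_comm _
    (hG'c.integrable_of_hasCompactSupport (HasCompactSupport.of_compactSpace _)), hzero, map_zero]

omit [CompleteSpace F] in
/-- The lift of the exterior derivative of a smooth form is `C^∞` (it is `extDeriv` of the
`C^∞` lift). [folklore] -/
theorem contDiff_liftForm_mextDeriv {β : MForm 𝓘(ℝ, E) (ComplexTorus Φ) F k} (hβ : IsSmoothForm β) :
    ContDiff ℝ ∞ (liftForm Φ (mextDeriv β)) := by
  rw [liftForm_mextDeriv]
  have h := (isSmoothForm_iff_contDiff_liftForm Φ β).1 hβ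
  have hD : ContDiff ℝ ∞ (fderiv ℝ (liftForm Φ β)) := h.fderiv_right (by simp)
  exact (ContinuousAlternatingMap.alternatizeUncurryFinCLM ℝ E F).contDiff.comp hD

/-- **Exact forms have average zero**: `avg α = 0` for every `α ∈ B^k(X)` (finite combinations
of `dβ`, `β` smooth). [cite: LangeBirkenhake1992, §1.1.4] -/
theorem avg_eq_zero_of_mem_exactSmoothForms {α : MForm 𝓘(ℝ, E) (ComplexTorus Φ) F k}
    (hα : α ∈ exactSmoothForms 𝓘(ℝ, E) (ComplexTorus Φ) F k) : avg Φ α = 0 := by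
  cases k with
  | zero =>
    have h0 : α = 0 := by simpa [exactSmoothForms] using hα
    rw [h0, avg_zero]
  | succ k =>
    -- induction over the span, carrying continuity of the lift (needed for additivity of `avg`)
    suffices h : Continuous (liftForm Φ α) ∧ avg Φ α = 0 from h.2
    refine Submodule.span_induction (p := fun α _ ↦ Continuous (liftForm Φ α) ∧ avg Φ α = 0)
      ?_ ?_ ?_ ?_ hα
    · rintro _ ⟨β, hβ, rfl⟩
      have hβ' : IsSmoothForm β := hβ
      exact ⟨(contDiff_liftForm_mextDeriv Φ hβ').continuous, avg_mextDeriv Φ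
        (((isSmoothForm_iff_contDiff_liftForm Φ β).1 hβ').of_le (by simp))⟩
    · refine ⟨?_, avg_zero Φ⟩
      rw [liftForm_zero]
      exact continuous_const
    · rintro α β - - ⟨hαc, hα0⟩ ⟨hβc, hβ0⟩
      refine ⟨?_, by rw [avg_add Φ hαc hβc, hα0, hβ0, add_zero]⟩
      rw [liftForm_add]
      exact hαc.add hβc
    · rintro r α - ⟨hαc, hα0⟩
      refine ⟨?_, by rw [avg_smul, hα0, smul_zero]⟩
      rw [liftForm_smul]
      exact hαc.const_smul r

/-- The average as a linear map on closed smooth forms. [folklore] -/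
def avgₗ : closedSmoothForms 𝓘(ℝ, E) (ComplexTorus Φ) F k →ₗ[ℝ] (E [⋀^Fin k]→L[ℝ] F) where
  toFun α := avg Φ α
  map_add' α β := avg_add Φ ((isSmoothForm_iff_contDiff_liftForm Φ _).1 α.2.1).continuous
    ((isSmoothForm_iff_contDiff_liftForm Φ _).1 β.2.1).continuous
  map_smul' r α := by
    simp only [Submodule.coe_smul, RingHom.id_apply]
    exact avg_smul Φ r α.1

omit [CompleteSpace F] in
/-- Unfolding of `avgₗ`. [folklore] -/
theorem avgₗ_apply (α : closedSmoothForms 𝓘(ℝ, E) (ComplexTorus Φ) F k) : avgₗ Φ α = avg Φ α := rfl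

/-- **The average on de Rham cohomology**, `avgClass : H^k_dR(X; F) → Alt^k(E; F)`,
`[α] ↦ ∫ₓ α` (well defined: exact forms have average zero). Lange–Birkenhake (1992), §1.1.4 /
Prop. 1.1.20 (the inverse of `IF^k(X) → H^k_dR(X)` on its image). [cite: LangeBirkenhake1992, Prop. 1.1.20] -/
def avgClass : deRhamCohomology 𝓘(ℝ, E) (ComplexTorus Φ) F k →ₗ[ℝ] (E [⋀^Fin k]→L[ℝ] F) :=
  Submodule.liftQ _ (avgₗ Φ) fun α hα ↦ by
    rw [LinearMap.mem_ker, avgₗ_apply]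
    exact avg_eq_zero_of_mem_exactSmoothForms Φ hα

/-- `avgClass [α] = avg α`. [folklore] -/
@[simp] theorem avgClass_mk (α : closedSmoothForms 𝓘(ℝ, E) (ComplexTorus Φ) F k) :
    avgClass Φ (deRhamCohomology.mk α) = avg Φ α :=
  rfl

/-- **`avgClass ∘ constClass = id`**: the average of the class of the invariant form `c` is `c`.
[cite: LangeBirkenhake1992, Prop. 1.1.20] -/
@[simp] theorem avgClass_constClass (c : E [⋀^Fin k]→L[ℝ] F) :
    avgClass Φ (constClass Φ c) = c := by
  rw [constClass_apply, avgClass_mk]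
  exact avg_constForm Φ c

/-- **The classes of the invariant forms are linearly independent in de Rham cohomology**:
`c ↦ [constForm Φ c]` is injective (the injectivity half of Lange–Birkenhake (1992),
Prop. 1.1.20, `IF^k(X) ≅ H^k_dR(X)`). [cite: LangeBirkenhake1992, Prop. 1.1.20] -/
theorem constClass_injective :
    Function.Injective (constClass Φ : (E [⋀^Fin k]→L[ℝ] F) → deRhamCohomology 𝓘(ℝ, E) (ComplexTorus Φ) F k) :=
  Function.LeftInverse.injective (g := avgClass Φ) (avgClass_constClass Φ)

/-- **A non-zero invariant form is not exact**: `constForm Φ c ∈ B^k(X) ↔ c = 0`.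
[cite: LangeBirkenhake1992, Prop. 1.1.20] -/
theorem constForm_mem_exactSmoothForms_iff (c : E [⋀^Fin k]→L[ℝ] F) :
    constForm Φ c ∈ exactSmoothForms 𝓘(ℝ, E) (ComplexTorus Φ) F k ↔ c = 0 := by
  refine ⟨fun h ↦ ?_, fun h ↦ by rw [h, constForm_zero]; exact Submodule.zero_mem _⟩
  rw [← avg_constForm Φ c]
  exact avg_eq_zero_of_mem_exactSmoothForms Φ h

end Forms

end ComplexTorus

end Literature.Geometry.Kaehler
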